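import Mathlib
import HarnessLib
import HarnessLib.Audit
import Summits.FinalStateConjecture.Statement
import Literature.Geometry.Lorentzian.WeightedNorms
import Literature.Geometry.Lorentzian.KerrDeSitterBackground
import Literature.Geometry.Lorentzian.ConformalInfinity
import Literature.Geometry.Lorentzian.LorentzianDistance
import Literature.Geometry.Lorentzian.ModelData
import HarnessLib.Audit.Status.Attr

/-!
Route: LambdaRegulator

DORMANT since 2026-08-23T06:30:23Z (reconciler: no traction for 5.9 d (last activity item-evidence-added at 2026-08-17T07:17:33Z); parked, not closed — `ledger route dormant route-FinalStateConjecture-LambdaRegulator --off` to reactivat) — unstaffed, not closed; items shared with open routes are served there. `ledger route dormant <id> --off` reactivates.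

# Route LambdaRegulator — regulate the infrared with Λ>0 — FSC is the ΛM²→0 limit of a uniform
Λ-settling theorem, transported by Cauchy stability

It suffices to show X = UniformLambdaSettling ∧ LimitTransport (plus MGHDExistence —
Choquet-Bruhat–Geroch for the admissible class, the Statement's anti-vacuity conjunct; a last-ranked
CRUX of this route since rev 7 so that `closes` is crux-only).
UniformLambdaSettling (the card's K1–K4 in ONE limit-ready typed statement; rev 6: re-typed to the
revised Statement p126844 and ANCHORED): for TAME-Christodoulou-generic admissible Λ = 0 data D (one
fixed end, immersed witness families — exactly the Statement's genericity) there is a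
smooth regularising family H ↦ D_H of complete solutions of the Λ = 3H² vacuum constraints through D
= D_0 whose Λ-vacuum maximal Cauchy
developments, for all 0 < H ≤ H₀, have complete future null infinity and look — in the Statement's
own currency of late charts from
boosted sub-extremal Kerr exteriors (orthochronous motions) and from a flat domain, C²
sup-deviations on (truncated) slabs, separation, sublinear excision,
honest growing near-zone radii, future-oriented chart time, every future-complete null ray from ι_H
X kept in the closure of the self-determined exterior O_H and
exhaustiveness of O_H — like ONE H-independent N-Kerr-plus-radiation final configuration, with
settling moduli
μ(R,τ), μ₀(τ) INDEPENDENT of H, a slack vanishing as H → 0⁺ LOCALLY UNIFORMLY in chart time (the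
slack carries the Kerr–de Sitter/Kerr and
de Sitter/Minkowski discrepancies O(H²R²), O(Hτ)), and an ANCHOR: H-independent age envelopes
A(R,τ), A₀(τ) < ∞ bounding the Lorentzian distance from ι_H X
to every certified slab (chart time cannot drift with H, so the H-independent moduli carry content;
route review 2026-08-16). LimitTransport (the card's dictionary lemma P2 made load-bearing): for
EVERY admissible
D, such anchored uniform Λ-settling of its regularisations forces every Λ = 0 MGHD of D to have
complete 𝓘⁺ and an exhaustive (honest radii), future-oriented sub-extremal
FinalStateDecomposition in C² whose exterior keeps every future-complete null ray from Σ in its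
closure — the re-typed Statement's conclusion, verbatim — by Cauchy stability in H on the anchored
slabs and a diagonal extraction of charts. Card realised:
lambda-infrared-regulator-punctured-scri (spine). The Λ > 0 engine by which UniformLambdaSettling is
to be PROVED — the fixed-Λ puncture
theorem on spacelike 𝓘⁺_Λ and Λ-uniform Kerr–de Sitter capture — is carried by the typed crux
PunctureTheorem and the informal crux UniformKdSCapture; the deciding theorem does not depend on
them.
Lean: `UniformLambdaSettling ∧ LimitTransport ∧ MGHDExistence`

## Assembly
Pure logic, proved sorry-free in Sketch.lean / glue.lean (`closes`, axioms propext ·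
Classical.choice · Quot.sound; `#h21_check_closes` ok):
unfold the Statement to `IsTameChristodoulouGeneric 𝓓 P 1` with P(D) = (∃ MGHD) ∧ (∀ MGHD, complete
𝓘⁺ ∧ sub-extremal decomposition with O = exteriorOf,
RaysStayInClosure, HasExhaustiveCharts, IsFutureOriented); LimitTransport and MGHDExistence give
Φ(D) → P(D) for every D ∈ 𝓓, so the exceptional set of P lies
inside that of Φ and every witness supplied by UniformLambdaSettling through a P-exceptional datum
(ONE end e and a tame, immersed, injective admissible family
leaving the Φ-exceptional set) also leaves the P-exceptional set: `HasTameCodimAtLeastIn` is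
monotone in the exceptional set (rev 6, 2026-08-16: re-elaborated
for the re-typed Statement p126844). The Assembly item below is the same implication by decl name.

Rationale: WHY THIS LINE. The conjecture's worst enemies are infrared — Price tails, logarithms at 𝓘⁺/i⁰,
'moving apart' as a t → ∞ kinematic statement — and one
positive constant Λ = 3H² turns future infinity into a smooth SPACELIKE hypersurface on which
surviving black holes are isolated points,
decay in each static patch is exponential, holes beyond a Hubble length are causally disconnected,
and the N = 1 theorem (Hintz–Vasy
arXiv:1606.04014, Fang arXiv:2112.07183) and the N ≥ 2 existence theorem (Hintz arXiv:2001.10401)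
are already in print, with full
sub-extremal LINEAR theory available (Petersen–Vasy arXiv:2112.01355, Hintz arXiv:2112.14431). The
line imports this Λ > 0 technology
(microlocal/Fredholm stability theory on Kerr–de Sitter, Friedrich's conformal field equations at
spacelike 𝓘⁺, the Valiente-Kroon school's
asymptotic points, book:kroon2016-conformal-methods-general-relativity) into the Λ = 0 problem
through a single typed bet: the settling
of the regularised developments is UNIFORM in ΛM² (Mavrogiannis arXiv:2111.09494/2111.09495 is the
linear a = 0 instance: Morawetz on
Schwarzschild–de Sitter with constants uniform as Λ → 0; Hintz–Xie doi:10.1063/5.0062985 the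
mode-level singular limit). What it adds to the
ledger: the hub's only other Λ-card (cosmological-constant-ladder) was declined as vacuous because
FSC_Λ alone says nothing the Statement
quantifies over; here the bridge is typed — UniformLambdaSettling is stated over the EXISTING Λ = 0
comparison backgrounds with Λ-vacuum
developments expressed through `CauchyDevelopment.IsMaximalAmong (Ric = 3H²g)` and the Λ-constraints
`R − |k|² + (tr k)² = 6H²`, and
`closes` is proved (genericity is monotone under implication). No probabilistic/spectral
reformulation is used; the physical analogy
(box normalisation) comes with its explicit dictionary: i⁺ ↦ finite puncture set on the PLANAR-END
COMPONENT of spacelike 𝓘⁺_Λ ≅ ℝ³ minus N points (upper-half-space model; the planar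
end's point at infinity p_∞ is singular — Hintz arXiv:2001.10401 §3.5, Thm 3.18 — and nothing is
claimed there; NOT S³, no balance law;
repair of 2026-08-15 after the crux attacks on PunctureTheorem); (Λᵢ, cᵢ) ↦ puncture + conformal
frame;
rate-free C² convergence ↦ H-independent moduli μ; Λ → 0 ↦ slack σ → 0.

RANKED CRUXES. REV 6 (route-repair 2026-08-16, Statement re-typed by p126844 + route review
rreview1-9250c668): UniformLambdaSettling, LimitTransport, UniformDispersal and PunctureTheorem were
RESTATED 1:1 (same decl names, new items): tame genericity (`IsTameChristodoulouGeneric`), the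
level-H property Φ tracks the revised Statement (honest radii, orthochronous motions +
future-directed push-forwards of Λᵢ V_{Mᵢ,aᵢ} / ∂₀, `RaysStayInClosure` of O_H) and is ANCHORED
(H-independent age envelopes A(R,τ), A₀(τ) < ∞ on the Lorentzian distance from ι_H X to the
certified slabs; slack → 0 locally uniformly in τ), LimitTransport concludes the revised Statement's
∀-MGHD clause verbatim; `closes` re-certified (axioms standard); rev 7 re-badged MGHDExistence
support→crux (last-ranked) because the deciding theorem may assume crux items only (layer invariant
2026-08-16). Two typed cruxes plus that anti-vacuity crux carry the deciding theorem; two further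
cruxes — UniformKdSCapture (card K1, rank 4; still informal, typeable
now that KerrDeSitter.data / dataWeightedSobolevEDistΛ have landed: tenure task) and PunctureTheorem
(card K2–K4 at fixed Λ, rank 5;
TYPED since the 2026-08-15 repair over KerrDeSitter.background + ConformalCompletion, see #5 below)
— are the intended PROOF of
UniformLambdaSettling and the route's cheapest kill switches, not hypotheses of `closes`.
#2 UniformLambdaSettling (crux) — [card K1+K2+K3+K4, limit-ready typed form; rev 6 anchored re-type]
For TAME-Christodoulou-generic admissible D (tame codimension 1 on one fixed end with immersed
witness families, exactly the re-typed Statement's genericity) there are a jointly smooth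
one-parameter family F of initial data with F(0) = D (parameter H = √(Λ/3)) and H₀ > 0 such that D_H
:= F(H), 0 < H ≤ H₀, is a complete solution of the Λ = 3H² vacuum constraints (R − |k|² + (tr k)² =
6H², div k − d tr k = 0; model: the umbilic shift (h, k + Hh), exact for maximal data, = de Sitter
flat slicing at infinity), together with ONE H-independent final configuration — N, sub-extremal
(Mᵢ, aᵢ), ORTHOCHRONOUS Poincaré motions (Λᵢ, cᵢ), late time τ₀, sublinear excision radii ρᵢ, flat
domain U₀ ⊇ late half-space minus tubes — H-independent moduli μ(R,τ), μ₀(τ) → 0 as τ → ∞, slacks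
σ(H,R,τ), σ₀(H,τ) → 0 as H → 0⁺ LOCALLY UNIFORMLY in τ (sup over τ ∈ [τ₀ + 1/T, T] for every T),
H-independent AGE ENVELOPES A(R,τ), A₀(τ) < ∞, separation times τsep(R) and HONEST growing radii Rgᵢ
→ ∞, Rgᵢ ≥ max(r₊(Mᵢ,aᵢ), 0) + 1, with μ(Rgᵢ(τ),τ) → 0, such that for every 0 < H ≤ H₀ a Λ-MGHD of
D_H exists (a CauchyDevelopment maximal among the Ric = 3H²g developments) and EVERY Λ-MGHD 𝒟_H (i)
has complete future null infinity in Christodoulou's sojourn form (WCC_Λ) and (ii) carries late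
charts Ψᵢ from the boosted Kerr exteriors and Ψ₀ from U₀ into the self-determined exterior O_H =
J⁺(ιX) ∩ I⁻(charted union) with near-zone C² deviation from boosted Kerr on the truncated slab (t*ᵢ
= τ, rᵢ ≤ R) at most μ(R,τ) + σ(H,R,τ), flat-slab C² deviation from η on (x⁰ = τ) at most μ₀(τ) +
σ₀(H,τ), every point of the certified slabs (t*ᵢ = τ, rᵢ ≤ R), (x⁰ = τ) ∩ U₀, τ > τ₀, at Lorentzian
distance (time separation) at most A(R,τ), A₀(τ) from ι_H X (THE ANCHOR: chart time is tied to
proper time since the data uniformly in H, so the H-independent moduli cannot be absorbed into per-H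
chart shifts — route review 2026-08-16), world-tubes (t*ᵢ > τ₁, rᵢ ≤ R) pairwise disjoint once τ₁ ≥
τsep(R), every future-complete normalised null ray from ι_H X in closure O_H (the Statement's
RaysStayInClosure at level H), the push-forwards of the transported Kerr time vectors Λᵢ V_{Mᵢ,aᵢ}
on the truncated slabs and of ∂₀ on the flat slabs eventually future-directed (the Statement's
IsFutureOriented at level H), and the Statement's exhaustiveness clause verbatim at level H with the
honest radii Rgᵢ. In words: watched up to any fixed chart time — which now means up to a fixed
proper time after the data — the Λ-regularised developments look like the Λ = 0 final state with an
error o(1) in τ UNIFORMLY in Λ plus o(1) in Λ locally uniformly in τ. Intended proof: fixed-Λ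
puncture theorem (informal crux PunctureTheorem) + Λ-uniform Kerr–de Sitter capture (informal crux
UniformKdSCapture) in norms interpolating e^(−κ_c t) and t^(−p). [difficulty: open-problem] (why it
might fail: Uniformity in ΛM² IS the Λ=0 difficulty relocated: the KdS spectral gap κ_c ~ H closes,
Mavrogiannis' uniform Morawetz (arXiv:2111.09494) is first-order and a=0 only, and the anchored
clause openly contains full-sub-extremal Kerr stability, no-hair, WCC_Λ and an interior claim
(complete null rays of the Λ-developments stay in closure O_H).) [arXiv:1606.04014,
arXiv:2112.07183, arXiv:2111.09494, arXiv:2111.09495, doi:10.1063/5.0062985, arXiv:2112.01355,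
arXiv:2112.14431, arXiv:2410.02341, arXiv:2001.10401, DafermosLuk2017]
#3 LimitTransport (crux) — [card P2, the Λ → 0 dictionary made load-bearing; rev 6 anchored re-type]
For EVERY admissible datum D (no genericity): if D admits a regularising family with anchored
uniform Λ-settling exactly as in UniformLambdaSettling (the same Φ(D), byte-identical), then every Λ
= 0 MGHD 𝒟 of D (VacuumCauchyDevelopment, IsMaximal) has complete future null infinity (sojourn
form) and there are O and an N-hole FinalStateDecomposition d of 𝒟 on O in C² with sub-extremal
holes, O = J⁺(ιX) ∩ I⁻(d.charted), RaysStayInClosure O, HasExhaustiveCharts d (honest radii) and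
IsFutureOriented d — the re-typed Statement's conclusion for D, verbatim. Mechanism: joint
smoothness of F gives D_H → D in C^∞_loc and D_H − D ≈ (0, Hh) sup-small; the age envelopes A(R,τ),
A₀(τ) place every certified level-H slab of chart time ≤ T within proper time A of ι_H X, uniformly
in H, so Cauchy stability holds on the relevant domains of dependence and, uniformly-locally, on
whole slabs for finite chart time; the C² deviation bounds give uniform C³ control of the H-charts
(∂²Ψ = Γ_model·∂Ψ − Γ_g∘Ψ·∂Ψ∂Ψ), hence Arzelà–Ascoli/diagonal extraction of Λ = 0 charts with
deviation ≤ μ, the limit development embedding in 𝒟 by maximality; separation, excision, orientation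
(a sign, stable under C⁰ limits of timelike push-forwards) and exhaustiveness pass to limits of
causal curves in compact regions; complete 𝓘⁺ at Λ = 0 either from whole-slab flat convergence +
exhaustiveness (ingoing rays from radius r₁ sojourn ≳ r₁ in J⁺(ιB₀) inside O) or contrapositively
from clause (i) by semicontinuity of the MGHD boundary; RaysStayInClosure at Λ = 0 from its level-H
counterpart only for ray segments of bounded age (the global clause is the delicate part). [deps:
UniformLambdaSettling] [difficulty: XL] (why it might fail: Cauchy stability moves compact-domain
facts only: complete 𝓘⁺, complete-ray membership in closure O and causal pasts / MGHD boundaries are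
global and can jump in the H → 0 limit (Cauchy horizons are unstable); a Λ=0-naked but Λ>0-censored
datum or loss of chart equicontinuity breaks it; complete scri at Λ=0 needs exterior control for
o₂(1/r) data.) [Ringstrom2009, ChoquetBruhatGeroch1969CMP, arXiv:1309.7591,
doi:10.1007/978-1-4612-2084-8, DafermosRodnianski2013, Christodoulou1999, LindbladRodnianski2010]
#5 PunctureTheorem (crux) — [card K2+K3+K4 at fixed Λ; repaired + typed 2026-08-15 after crux
attacks g0/g2 (refuted-misstated: 'one-point-compactified ℝ³ / S³ scri, regular at p_∞' is false
already for planar de Sitter and for Hintz's KdS-with-planar-end g_{p,m}; sojourn-form WCC_Λ is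
contentless at Λ > 0; 'bound clusters merge' is false for the DGSW/DSW stationary binaries)] For
TAME-Christodoulou-generic admissible D (rev 6: the re-typed Statement's genericity): a regularising
family F (same clause as UniformLambdaSettling), H₀ and an H-INDEPENDENT census (N₀; compact K of
sub-extremal Kerr parameters) such that for all 0 < H ≤ H₀ every Λ-MGHD of F(H) has N ≤ N₀ holes
(Mᵢ, aᵢ) ∈ K, KdS-subextremal at Λ = 3H²; a C² conformal completion whose 𝓘⁺ is the whole planar-end
component (the far data end expands to it; black-hole region minimal among such connected
completions), homeomorphic to ℝ³ minus N points; N static-patch late charts from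
KerrDeSitter.background(Mᵢ, aᵢ, 3H², r₊) into O = J⁺(ιX) ∩ I⁻(𝓘⁺) with truncated C² deviation → 0
for every R and eventual disjointness; WCC_Λ ON THE CONFORMAL BOUNDARY (no future-incomplete
future-directed causal geodesic avoids B = M ∖ J⁻(𝓘⁺)); exhaustion by observers (every
future-complete timelike geodesic avoiding B ends at a point of 𝓘⁺ or in a static patch). Informal
riders: e^(−κτ) rate, conformal data (h_𝓘, D) with D ~ mᵢ(3ν⊗ν − h)/ρ³ at pᵢ, generic instability of
stationary multi-horizon states. [difficulty: open-problem] (why it might fail: open at every leg; a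
dynamically stable spinning dS binary (arXiv:2406.10333, open) refutes it on an open set; KdS
uniqueness unproved (arXiv:1711.07024); Zeno cascades = the Λ = 0 finiteness sub-crux; H-uniform
census and a unique planar conformal boundary are extra bets.) [arXiv:2001.10401, arXiv:1606.04014,
arXiv:2112.07183, arXiv:2303.07361, arXiv:2406.10333, arXiv:1711.07024,
doi:10.1016/0393-0440(86)90004-5, doi:10.1007/s00222-008-0117-y, arXiv:hep-th/0202161]
#9 MGHDExistence (crux, last-ranked; support until rev 7, re-badged for the crux-only deciding
theorem — known in print, typing-exposed: IsMaximal needs every typed vacuum Cauchy development to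
embed, cf. VacuumDevelopment.isEmpty) — [shared verbatim with the sibling FSC routes' MGHDExistence,
e.g. route-FinalStateConjecture-BurnettKineticRigidity] Choquet-Bruhat–Geroch for the admissible
class over the repaired structure: every admissible datum (smooth solution of the vacuum
constraints) has a maximal vacuum Cauchy development (VacuumCauchyDevelopment D, IsMaximal) — the
anti-vacuity conjunct of the Statement; it is the unproved tree fact
`choquetBruhat_geroch_exists_mghd_cauchy`
(Literature/Geometry/Lorentzian/CauchyProblemMGHDExistence.lean; restriction lemma
`forall_mem_admissibleVacuumData` in AdmissibleMGHDExistence.lean) restricted to admissible data.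
[difficulty: XL] [ChoquetBruhatGeroch1969CMP, Ringstrom2009, arXiv:1309.7591]
#9 RegularisationExists (support) — the cheap half of UniformLambdaSettling, for EVERY admissible
datum: D = (h, k) lies on a jointly smooth one-parameter family F with F(0) = D and F(H), 0 < H ≤
H₀, a complete solution of the Λ = 3H² vacuum constraints. Intended proof: implicit function theorem
for Θ(H, γ, π) := C₀(h + γ, k + π) + 4H (tr(k + π), 0) — the Λ-constraint map of the umbilically
shifted datum (h + γ, k + π + H(h + γ)) — around (0, 0, 0), in weighted spaces on the AF end where
the linearised vacuum constraint map is a submersion modulo the finite-dimensional KID cokernel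
(Lyapunov–Schmidt step at symmetric data); the shift absorbs the non-decaying 6H² exactly, the
residual 4H tr k = H·o(r⁻²) decays; completeness survives the decaying correction. [difficulty: M]
[arXiv:gr-qc/0301073, arXiv:gr-qc/0301071, BartnikIsenberg2004]

TWO-LAYER PLAN. Foreseen glued splits (k ≤ 3, depth 1; nothing filed now). UniformLambdaSettling ⇐
UniformEntry → UniformCapture → UniformLambdaSettling:
UniformEntry = by an H-independent chart time T(D) every Λ-MGHD of D_H is ε₀-close (in the capture
norm) to an N-Kerr–de Sitter + de
Sitter configuration; UniformCapture = the typed form of the informal crux UniformKdSCapture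
(Λ-uniform multi-KdS stability) — both need
the definition request KerrDeSitter.background/data, which is why they are not items now. First rung
(special case, same split):
UniformDispersal (N = 0; rev 6: re-typed with the same anchor A₀, locally uniform slack,
RaysStayInClosure and ∂₀-orientation clauses): Λ → 0⁺-uniform small-data dispersal, i.e. stability
of Minkowski recovered as the uniform limit of flat-slicing de
Sitter stability (Friedrich doi:10.1016/0393-0440(86)90004-5, Ringström
doi:10.1007/s00222-008-0117-y causal localisation, LindbladRodnianski2010) for the umbilic
regularisation
(h, k + Hh) — the cheapest NONLINEAR test of the whole line. LimitTransport ⇐ ChartExtraction →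
ScriAndExhaustionTransfer → LimitTransport
(compactness of almost-isometric charts; the two late-time clauses at Λ = 0). PunctureTheorem ⇐
StaticPatchCapture → IsolationOfPunctures →
GenericMultiHorizonInstability (NOT a rigidity leg: KdS is not unique among stationary Λ-vacuum
black-hole configurations inside a
cosmological horizon — DGSW arXiv:2303.07361, DSW arXiv:2406.10333 binaries — so the leg reads
'every stationary Λ-vacuum exterior
configuration other than finitely many separated sub-extremal KdS patches is dynamically unstable,
stable manifold ⊆ exceptional set').

KILL CRITERIA. - UniformKdSCapture refuted — already at the LINEAR level by the cheapest falsifier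
below (no Λ-uniform commuted Morawetz/r^p hierarchy on
  Schwarzschild–de Sitter in interpolating norms) — kills the only proof strategy for
UniformLambdaSettling: close `refuted:UniformKdSCapture`
  unless a different uniform mechanism is named in the same edit.
- UniformLambdaSettling refuted directly (e.g. a generic open set of data whose regularised census
N(H), masses or boosts do not stabilise
  as H → 0⁺, or for which WCC_Λ fails at small Λ): close `refuted:UniformLambdaSettling`.
- LimitTransport refuted by an explicit admissible datum that is Λ=0-naked yet Λ>0-censored for all
small Λ (or by a jump of causal pasts in
  the limit): pivot, not close — restate LimitTransport with a per-H UNIFORM sojourn clause /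
uniform exhaustiveness and ray-incompleteness moduli added to Φ (and the
  same text in UniformLambdaSettling), one `--restate` each (rev 6 already added the age anchor and
the locally uniform slack this way).
- PunctureTheorem refuted at fixed Λ — an open set of admissible data whose regularised developments
carry infinitely many (or
  H-unboundedly many / arbitrarily light) punctures, a DYNAMICALLY STABLE stationary non-Kerr–de
Sitter Λ-vacuum exterior configuration
  (e.g. a spin-stabilised Dias–Santos–Way binary inside one cosmological horizon, arXiv:2406.10333
p. 5 — open), or a generic WCC_Λ
  failure visible from the planar scri: the Λ > 0 engine is dead; close `refuted:PunctureTheorem`.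
NOT a kill (reworded 2026-08-15): the
  mere existence of stationary multi-horizon Λ-vacuum states — the DGSW static binaries
(arXiv:2303.07361) are Newton–Hooke saddles
  (4M/d³ + H² = 3H² > 0) and belong to the exceptional set.
- Mooted: a Λ = 0 route proving the Statement, or full-sub-extremal multi-Kerr stability + a
formation/entry theorem at Λ = 0, supersedes
  this line (`superseded --by`).

NOT DECOMPOSED YET. The Entry/Capture split of UniformLambdaSettling and its N = 0 rung (need
Kerr–de Sitter definitions); the interpolating norms
(e^(−κ_c t) ↔ t^(−p)) in which uniformity is claimed — deliberately not fixed in the typed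
statement, which is rate-free like the Statement;
the chart-extraction and 𝓘⁺-transfer lemmas inside LimitTransport; the KID/Lyapunov–Schmidt step
inside RegularisationExists; inside
PunctureTheorem: the conformal constraint data (h_𝓘, D) on the planar scri, the point-charge
asymptotics D ~ mᵢ(3ν⊗ν − h)/ρ³ and the ten
residues (mass, position, spin, boost), the exponential rate and the sub-Nariai/MOTS bookkeeping —
riders of the typed item (which uses
the bare C² ConformalCompletion of ConformalInfinity.lean), to become items only if a prover asks
for a ConformalBoundaryData definition;
the typing of UniformKdSCapture (definitions landed; tenure). DESIGN FLAGS for tenure: (a) the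
sojourn-form
`HasCompleteNullInfinity` clause at level H in UniformLambdaSettling / LimitTransport /
UniformDispersal is H-trivially weak at Λ > 0
(refuter g0/g2 on 10111; Ringström far-region completeness) — the conformal-boundary WCC_Λ clause of
PunctureTheorem is the candidate
replacement (no change in rev 6); (b) the chart-time anchoring flag (retriage 2026-08-15, refuter
g43-14, route review rreview1 2026-08-16) is RESOLVED in rev 6 by the age envelopes A, A₀
(lorentzDist from ι_H X) and the locally uniform slack — reconstructed from the review note (its
AnchoredPhi.lean was not readable on this hub), with the anchor demanded on certified slabs of chart
time τ > τ₀ only; (c) the level-H orientation clause is 'eventually in τ' per H (the Statement's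
shape), not H-uniform — LimitTransport reads the sign off small-deviation slabs. Everything about Λ
< 0 (irrelevant: reflective).

CHEAPEST FALSIFIER. LINEAR (the card's, sharpened): on Schwarzschild–de Sitter (M, Λ = 3H²) ask
whether Mavrogiannis' 'without relative degeneration'
constants (arXiv:2111.09494: a = 0, first order) stay uniform in ΛM² → 0 AFTER commutation with T, Ω
and the r^p multipliers the Λ = 0
proofs need (DRSR/DHRT weights) on r ≲ H⁻¹, in norms interpolating e^(−κ_c t) and t^(−p): exhibit,
if it exists, a family ψ_H of
unit-energy solutions supported near r = 3M whose weighted flux through t = c·M·log(1/ΛM²) stays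
bounded below while the would-be
uniform estimate forces o(1). A counterexample kills UniformKdSCapture and with it the proof
strategy of the rank-2 crux. Not run here
(no kit in plancard mode); lookup: no uniform COMMUTED estimate is in print (Mavrogiannis uncommuted
a = 0; Hintz–Xie
doi:10.1063/5.0062985 single modes, singular limit). Second cheapest (nonlinear, N = 0): Λ →
0⁺-uniform dispersal of the umbilic
regularisation (h, k + Hh) of small data on whole slabs — if Minkowski stability is not the uniform
limit of flat-slicing de Sitter
stability, UniformLambdaSettling is false outright.

NUMBERS. Λ = 3H²; Λ-constraints R − |k|² + (tr k)² = 2Λ = 6H², div k − d tr k = 0 (de Sitter flat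
slicing: h = a²δ, k = Hh gives −3H² + 9H² = 6H²);
umbilic shift of vacuum data: Hamiltonian(h, k + Hh) = 4H tr k + 6H² (exact iff maximal).
Schwarzschild–de Sitter exists iff 9ΛM² < 1
(sub-Nariai); cosmological surface gravity κ_c ≈ H for ΛM² ≪ 1, so the KdS spectral gap is O(H) → 0
— versus the Λ = 0 Price tail c t⁻³
(Literature.Barriers.FinalStateConjecture.PriceLawTail). Discrepancies carried by the slack: SdS vs
Schwarzschild on r ≤ R: H²R² (f = 1 −
2M/r − H²r²); de Sitter flat slicing vs η on a whole slab at time τ: e^(2Hτ) − 1 ≈ 2Hτ, ∂g ~ H, ∂²g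
~ H². Tidal (Hill) radius of a hole of
mass M in de Sitter: (M/H²)^(1/3) — punctures of masses ≥ m₀ ending at distinct points are separated
by conformal angle ≳ (m₀H)^(1/3).
N = 1 at Λ > 0: nonlinear stability of KdS for |a| ≪ M (arXiv:1606.04014 Thm 1.1; arXiv:2112.07183);
linear theory for all |a| < M
sub-extremal KdS modulo mode stability (arXiv:2112.01355), mode stability for ΛM² ≪ 1 at fixed |a|/M
< 1 (arXiv:2112.14431). Λ = 0
frontier: |a| ≪ M (KlainermanSzeftel2023); full-range energy–Morawetz arXiv:2410.02341. Λ > 0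
binaries: DGSW static binary separation d³ = 2M/H² (= 2 × Hill radius³), restoring coefficient 4M/d³
+ H² = 3H² (saddle,
e-folding rate √3·H); MOTS area bound A < 4π/Λ (Hayward–Shiromizu–Nakao 1994) makes sub-Nariai
automatic; 9ΛM² < 1 ⇔ 27H²M² < 1.
Items: 5 at open (2 typed cruxes, 2 support, assembly) + UniformDispersal (support, rev 4) +
PunctureTheorem typed (repair 2026-08-15) +
UniformKdSCapture informal; both definition requests landed; rev 6 (2026-08-16) restated
ULS/LT/UD/PT for the re-typed Statement (new item ids, same decl names) and added the import
LorentzianDistance. Negatives index checked 2026-08-16.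

DEFINITION REQUESTS. - KerrDeSitter.background (M a Λ : ℝ) : ModelBackground (topic
Literature/Geometry/Lorentzian, beside `Kerr.background`): the Kerr–de
  Sitter metric in Kerr–Schild form on the de Sitter background (Gibbons–Lü–Page–Pope, J. Geom.
Phys. 53 (2005); Akcay–Matzner CQG 28
  (2011) 085012), in Cartesian-type coordinates regular across BOTH the event and the cosmological
horizon, with time and radius functions
  — LANDED (Literature/Geometry/Lorentzian/KerrDeSitter.lean + KerrDeSitterBackground.lean:
star-chart of Hintz–Vasy/Petersen–Vasy,
  `KerrDeSitter.background M a Λ r₀`, `Spacetime.ConvergesToKerrDeSitter`); consumed by the typed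
PunctureTheorem.
- KerrDeSitter.data (M a Λ r₀ : ℝ): the induced data on the slice t* = 0, r > r₀ of that chart, and
a Λ-version of
  `InitialDataSet.dataWeightedSobolevEDist` adapted to de Sitter-like ends — LANDED
(KerrDeSitterData.lean `KerrDeSitter.data`,
  WeightedNormsLambda.lean `dataWeightedSobolevEDistΛ`); UniformKdSCapture can now be typed
(tenure).
- (not filed now) ConformalBoundaryData (h_𝓘, D) at spacelike 𝓘⁺_Λ with IsKdSPuncture — only if a
prover of PunctureTheorem asks for
  Friedrich's formulation (the typed item uses `ConformalCompletion` of ConformalInfinity.lean, C²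
unphysical metric, no boundary data).

Novelty: Searches (2026-08-15, this session; searchd FTS leg rc 75 most of the session, vector leg + galaxy +
citation graph worked): `lit frontier
FinalStateConjecture --since 2021` (30 rows; relevant: arXiv:2112.07183 Fang, KdS nonlinear
stability, Annals of PDE 2026; arXiv:2601.01517
multi-black-hole Cauchy data; nothing on Λ → 0 limits); `lit bridges FinalStateConjecture --cross
any` (30 rows, surveys); `lit search --hybrid
"Schwarzschild-de Sitter uniform small cosmological constant Morawetz"` (vector leg, 10 books:
book:kroon2016-conformal-methods-general-relativity
pp 287, 458 = conformal field equations at spacelike scri / asymptotic points, the rest textbooks);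
`lit vsearch "estimates on Schwarzschild-de
Sitter uniform as the cosmological constant tends to zero …" --papers` (0); `lit galaxy search
"Kerr-de Sitter" --star pdf` (12: Hintz cone
points, Hintz gluing small black holes along timelike geodesics (Λ allowed), Drouot SdS Hawking
radiation, Petersen–Vasy absent from this
page); `lit galaxy search "Kerr-de Sitter limit cosmological constant to zero uniform estimates"
--star all` (0); `lit search --source crossref` ×3 ("Quasinormal modes of small Schwarzschild-de
Sitter black holes" → doi:10.1063/5.0062985 confirmed; "vanishing cosmological constant limit
Kerr-de Sitter Kerr stability uniform" 8 rows, astrophysics + Fang's thesis; "Minkowski stability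
limit de Sitter …" S2 429); OpenAlex daily budget exhausted; plus the card's own sweep
(galaxy "Kerr-de Sitter" 40 rows, "  [refs: 10.1063/5.0062985, 2112.07183, 2601.01517, 2111.09494, 2111.09495, 1606.04014, 2001.10401, book:kroon2016-conformal-methods-general-relativity, doi:10.1063/5.0062985]

Barriers (technique_class: Lambda-regularisation, KdS-transfer, Lambda-to-zero-limit): - technique_class: Lambda-regularisation, KdS-transfer, Lambda-to-zero-limit
- Literature.Barriers.FinalStateConjecture.PriceLawTail: its clause (2) blocks 'direct transfer to Λ
= 0 of the KdS stability PROOF with its exponential rates'. The typed items transfer no rate: μ, μ₀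
are rate-free moduli exactly like the Statement's C² convergence, and the slack σ is where e^(−κ_c
t) lives at fixed Λ; UniformKdSCapture must be proved in Λ-dependent norms degenerating to the
DRSR/DHRT polynomial weights (the barrier's recorded evasion 'work with inverse-polynomial decay
throughout') — it does not evade the barrier's 'because' (no spectral gap at σ = 0 for Λ = 0); the
bet is that uniformity survives commutation as it does for first-order Morawetz on SdS
(arXiv:2111.09494), and the cheapest falsifier tests exactly this.
- Literature.Barriers.FinalStateConjecture.SlowlyRotatingKerrFrontier: evaded at fixed Λ > 0 (full
sub-extremal linear theory, arXiv:2112.01355 + arXiv:2112.14431, no small-a absorption); NOT evaded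
in the limit — the N = 1 case of UniformLambdaSettling + LimitTransport contains the
full-sub-extremal Kerr stability conclusion (rate-free form), so `KerrStabilityHoldsBelow 1`-type
content is relocated into uniformity, openly (rank 2, why-it-might-fail).
- Literature.Barriers.FinalStateConjecture.KehrbergerLogarithmicAsymptoticsCorrected: evaded — no
smooth NULL infinity, peeling or conformal compactification at Λ = 0 is used (C² sup norms on slabs,
sojourn-form 𝓘⁺, as the

History (route lifecycle, newest last):
- 2026-08-15T22:02:19Z · rev 5: restated PunctureTheorem (stmt-FinalStateConjecture-10111) — route-repair (rrefute 80f23f9d): PunctureTheorem (stmt-FinalStateConjecture-10111) refuted-MISSTATED by crux attacks g0/g2 (evidence CRUX_ATTACK.md, CRUX_ATTACK (planner-rrefute-FinalStateConjecture-LambdaReg-80f23f9d-0)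
- 2026-08-16T23:19:21Z · rev 6: restated UniformLambdaSettling (stmt-FinalStateConjecture-10059), LimitTransport (stmt-FinalStateConjecture-10060), UniformDispersal (stmt-FinalStateConjecture-11113), PunctureTheorem (stmt-FinalStateConjecture-13855) — route-repair (rrepair 8e5527cc, statement-revised p126844, 2026-08-16): re-type T2 threaded t (planner-rrepair-FinalStateConjecture-LambdaReg-8e5527cc-0)
- 2026-08-16T23:48:33Z · rev 11: restated UniformDispersal (stmt-FinalStateConjecture-17442) — route-repair (rbadge 9250c668, 2026-08-16). (1) GLUE: the needs_repair stamp 'glue.unproved: route file no longer builds (fullbuild) LambdaRegulator.lean:505:84 (planner-rbadge-FinalStateConjecture-LambdaRegu-9250c668-0)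
- 2026-08-16T23:50:36Z · rev 12: restated UniformDispersal (stmt-FinalStateConjecture-18032) — route-repair (rbadge 9250c668, cont.): rev 11 replaced the ROUTE-level import list (ModelData gone from payload.imports) but the rendered file still imports Lit (planner-rbadge-FinalStateConjecture-LambdaRegu-9250c668-0)
- 2026-08-16T23:51:34Z · rev 13: dropped stmt-FinalStateConjecture-11113, stmt-FinalStateConjecture-17442, stmt-FinalStateConjecture-18032 — route-repair (rbadge 9250c668, cont.): detach the three REPLACED (inactive, closed:retired) UniformDispersal records 11113/17442/18032 from this route — their w (planner-rbadge-FinalStateConjecture-LambdaRegu-9250c668-0)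
- 2026-08-23T06:30:23Z · DORMANT — reconciler: no traction for 5.9 d (last activity item-evidence-added at 2026-08-17T07:17:33Z); parked, not closed — `ledger route dormant route-FinalStateConjec (operator:999:3625913)

sub-problem: FinalStateConjecture · status: dormant · opened planner-plancard-FinalStateConjecture-FinalSt-fdacab36-0 2026-08-15T15:06:23Z · rev 13 · ledger route-FinalStateConjecture-LambdaRegulator
GENERATED by the gate from the ledger (D-0016/17). Provers cite these decls: `theorem foo : Summit.FinalStateConjecture.FinalStateConjecture.Theses.LambdaRegulator.<Decl> := …` in Summits/FinalStateConjecture/FinalStateConjecture/Theorems/<Name>.lean.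
-/

namespace Summit.FinalStateConjecture.FinalStateConjecture.Theses.LambdaRegulator

open scoped BigOperators Topology Manifold Classical MeasureTheory ProbabilityTheory Matrix InnerProductSpace ComplexConjugate ContinuousMap ContDiff
open Filter Set Function TopologicalSpace MeasureTheory

attribute [summit_statement] _root_.FinalStateConjecture

-- earlier UniformLambdaSettling (stmt-FinalStateConjecture-10059, replaced 2026-08-16T23:19:21Z -> stmt-FinalStateConjecture-17440): retired by None — ∀ (X : Type) [TopologicalSpace X] [ChartedSpace Literature.Geometry.Lorentzian.E3 X] [IsManifold (𝓡 3) ∞ X] [T2Space X] [SecondCountableTopology X] [ConnectedSpace X], Literature.Geometry.Lorentzian.InitialDataSet.IsChristodoulouGeneric (Literature.Ge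
/-- item stmt-FinalStateConjecture-17440 · crux · rank 2 · open · by planner
why it might fail: For tame-generic LARGE data, all small Λ: WCC_Λ, finitely-many-KdS settling incl. KdS rigidity (open, 1711.07024), census continuous at Λ=0⁺, H-uniform ages A and N≥2 capture though κ_c~H→0 (only uncommuted Λ-uniform Morawetz, 2111.09494), level-H complete rays in closure O_H (interior claim).
sources: arXiv:1606.04014, arXiv:2112.07183, arXiv:2111.09494, arXiv:2111.09495, arXiv:2503.22077, doi:10.1063/5.0062985
[crux] [card K1+K2+K3+K4, limit-ready typed form; rev 6: re-typed to Statement p126844 + anchored]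
For TAME-Christodoulou-generic admissible D (one fixed end, immersed families): a jointly smooth
regularising family F, F(0) = D, F(H) (0 < H ≤ H₀) complete Λ = 3H² constraint solutions, and ONE
H-independent configuration — N, sub-extremal (Mᵢ, aᵢ), orthochronous motions (Λᵢ, cᵢ), τ₀,
sublinear excision ρᵢ, U₀ — with H-independent moduli μ(R,τ), μ₀(τ) → 0 (τ → ∞), slacks σ, σ₀ → 0 as
H → 0⁺ locally uniformly in τ, age envelopes A(R,τ), A₀(τ) < ∞, τsep(R), honest radii Rgᵢ → ∞ (≥
max(r₊,0)+1, μ(Rgᵢ(τ),τ) → 0), such that for all 0 < H ≤ H₀ a Λ-MGHD of F(H) exists and EVERY Λ-MGHD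
has complete 𝓘⁺ (sojourn form) and late charts Ψᵢ (boosted Kerr exteriors), Ψ₀ (U₀) into O_H =
J⁺(ι_H X) ∩ I⁻(charted) with: C² deviation ≤ μ + σ(H) on truncated slabs / ≤ μ₀ + σ₀(H) on flat
slabs (τ > τ₀); every point of those slabs at Lorentzian distance ≤ A(R,τ), A₀(τ) from ι_H X
(anchor); tubes disjoint after τsep(R); RaysStayInClosure O_H; push-forwards of Λᵢ V_{Mᵢ,aᵢ} and ∂₀
eventually future-directed; exhaustiveness of O_H by the certified slabs with radii Rgᵢ (the
Statement's clauses verbatim at level -/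
@[route_item "route-FinalStateConjecture-LambdaRegulator", crux]
def UniformLambdaSettling : Prop :=
  open Literature.Geometry.Lorentzian Summit.FinalStateConjecture in ∀ (X : Type) [TopologicalSpace X] [ChartedSpace E3 X] [IsManifold (𝓡 3) ∞ X] [T2Space X] [SecondCountableTopology X] [ConnectedSpace X], InitialDataSet.IsTameChristodoulouGeneric (admissibleVacuumData X) (fun D ↦ ∃ (F : EuclideanSpace ℝ (Fin 1) → InitialDataSet (𝓡 3) X) (H₀ : ℝ), InitialDataSet.IsSmoothDataFamily 1 F ∧ F 0 = D ∧ 0 < H₀ ∧ (∀ H : ℝ, 0 < H → H ≤ H₀ → let D' := F (EuclideanSpace.single 0 H); ∀ [D'.metric.HasLeviCivita], (∀ x, D'.hamiltonianConstraintFn x = 6 * H ^ 2 ∧ D'.momentumConstraintFn x = 0) ∧ D'.IsComplete) ∧ ∃ (N : ℕ) (mass spin : Fin N → ℝ) (motion : Fin N → lorentzGroup × E4) (τ₀ : ℝ) (ρ : Fin N → ℝ → ℝ) (U₀ : TopologicalSpace.Opens E4) (μ : ℝ → ℝ → ENNReal) (μ₀ : ℝ → ENNReal) (σ : ℝ → ℝ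 → ℝ → ENNReal) (σ₀ : ℝ → ℝ → ENNReal) (A : ℝ → ℝ → ENNReal) (A₀ : ℝ → ENNReal) (τsep : ℝ → ℝ) (Rg : Fin N → ℝ → ℝ), let B : Fin N → ModelBackground := fun i ↦ boostedKerrBackground (motion i).1 (motion i).2 (mass i) (spin i); let B₀ : ModelBackground := Minkowski.backgroundOn U₀; (∀ i, Kerr.IsSubextremal (mass i) (spin i)) ∧ (∀ i, IsOrthochronous (motion i).1) ∧ (∀ R, Filter.Tendsto (μ R) Filter.atTop (𝓝 0)) ∧ Filter.Tendsto μ₀ Filter.atTop (𝓝 0) ∧ (∀ R T, Filter.Tendsto (fun H ↦ ⨆ τ ∈ Set.Icc (τ₀ + T⁻¹) T, σ H R τ) (𝓝[>] 0) (𝓝 0)) ∧ (∀ T, Filter.Tendsto (fun H ↦ ⨆ τ ∈ Set.Icc (τ₀ + T⁻¹) T, σ₀ H τ) (𝓝[>] 0) (𝓝 0)) ∧ (∀ R τ, A R τ < ⊤) ∧ (∀ τ, A₀ τ < ⊤) ∧ (∀ i, Filter.Tendsto (fun τ ↦ μ (Rg i τ) τ) Filter.atTop (𝓝 0)) ∧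 (∀ i, Filter.Tendsto (Rg i) Filter.atTop Filter.atTop ∧ ∀ τ, max (Kerr.rPlus (mass i) (spin i)) 0 + 1 ≤ Rg i τ) ∧ (∀ i, Filter.Tendsto (fun t ↦ ρ i t / t) Filter.atTop (𝓝 0)) ∧ {x : E4 | τ₀ < x 0 ∧ ∀ i, ρ i (x 0) < (B i).radius x} ⊆ (U₀ : Set E4) ∧ ∀ H : ℝ, 0 < H → H ≤ H₀ → let IsΛMGHD : CauchyDevelopment (F (EuclideanSpace.single 0 H)) → Prop := fun 𝒟 ↦ 𝒟.IsMaximalAmong (fun 𝒟' ↦ ∀ [𝒟'.metric.toPseudoRiemannianMetric.HasLeviCivita], 𝒟'.metric.toPseudoRiemannianMetric.IsEinsteinVacuum (3 * H ^ 2)); (∃ 𝒟, IsΛMGHD 𝒟) ∧ ∀ 𝒟, IsΛMGHD 𝒟 → HasCompleteNullInfinity 𝒟 ∧ ∃ (Ψ : ∀ i, (B i).domain → 𝒟.carrier) (Ψ₀ : B₀.domain → 𝒟.carrier), let O : Set 𝒟.carrier := exteriorOf 𝒟 ((⋃ i, Ψ i '' (B i).lateRegion τ₀) ∪ Ψ₀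 '' B₀.lateRegion τ₀); (∀ i, 𝒟.toSpacetime.IsLateChart (B i) O τ₀ (Ψ i)) ∧ 𝒟.toSpacetime.IsLateChart B₀ O τ₀ Ψ₀ ∧ (∀ i R τ, τ₀ < τ → 𝒟.toSpacetime.truncDeviationCk (B i) (Ψ i) 2 R τ ≤ μ R τ + σ H R τ) ∧ (∀ τ, τ₀ < τ → 𝒟.toSpacetime.deviationCk B₀ Ψ₀ 2 τ ≤ μ₀ τ + σ₀ H τ) ∧ (∀ i R τ, τ₀ < τ → ∀ x ∈ (B i).truncTimeSlab R τ, ∀ y : X, 𝒟.toSpacetime.lorentzDist (𝒟.embed y) (Ψ i x) ≤ A R τ) ∧ (∀ τ, τ₀ < τ → ∀ x ∈ B₀.timeSlab τ, ∀ y : X, 𝒟.toSpacetime.lorentzDist (𝒟.embed y) (Ψ₀ x) ≤ A₀ τ) ∧ (∀ R τ₁, τsep R ≤ τ₁ → Pairwise (Function.onFun Disjoint fun i ↦ Ψ i '' (B i).truncLateRegion τ₁ R)) ∧ RaysStayInClosure 𝒟 O ∧ (∀ i (R : ℝ), ∀ᶠ τ in Filter.atTop, ∀ x ∈ (B i).truncTimeSlab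 R τ, 𝒟.timeOrientation.IsFutureDirected (mfderiv 𝓘(ℝ, E4) (𝓡 4) (Ψ i) x (((motion i).1 : E4 ≃L[ℝ] E4) (Kerr.timeVector (mass i) (spin i) (poincareInv (motion i).1 (motion i).2 (x : E4)))))) ∧ (∀ᶠ τ in Filter.atTop, ∀ x ∈ B₀.timeSlab τ, 𝒟.timeOrientation.IsFutureDirected (mfderiv 𝓘(ℝ, E4) (𝓡 4) Ψ₀ x (E4.basisVector 0))) ∧ (∀ τ₁, τ₀ < τ₁ → O \ (Ψ₀ '' B₀.lateRegion τ₁ ∪ ⋃ i, Ψ i '' {x | τ₁ < (B i).time x.1 ∧ (B i).radius x.1 ≤ Rg i ((B i).time x.1)}) ⊆ 𝒟.metric.causalPast 𝒟.timeOrientation (Ψ₀ '' B₀.timeSlab τ₁ ∪ ⋃ i, Ψ i '' (B i).truncTimeSlab (Rg i τ₁) τ₁))) 1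

-- earlier LimitTransport (stmt-FinalStateConjecture-10060, replaced 2026-08-16T23:19:21Z -> stmt-FinalStateConjecture-17441): retired by None — ∀ (X : Type) [TopologicalSpace X] [ChartedSpace Literature.Geometry.Lorentzian.E3 X] [IsManifold (𝓡 3) ∞ X] [T2Space X] [SecondCountableTopology X] [ConnectedSpace X], ∀ D ∈ Literature.Geometry.Lorentzian.admissibleVacuumData X, (∃ (F : EuclideanSpace ℝ (Fin
/-- item stmt-FinalStateConjecture-17441 · crux · rank 3 · open · by planner
why it might fail: Cauchy stability moves compact-domain facts only: anchored slabs converge, but complete 𝓘⁺, complete rays in closure O and causal pasts/MGHD boundaries are global and can jump as H→0 (Cauchy horizons unstable; Kroon 2022 Thm 12.3 is finite-time); a Λ=0-naked yet Λ>0-censored datum kills it.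
sources: Ringstrom2009, book:kroon2022-conformal-methods-general-relativity, ChoquetBruhatGeroch1969CMP, arXiv:1309.7591, KlainermanNicolo2003, DafermosRodnianski2013
[crux] [card P2, the Λ → 0 dictionary made load-bearing; rev 6 anchored re-type] For EVERY
admissible D: the anchored uniform Λ-settling property Φ(D) of UniformLambdaSettling
(byte-identical) implies, for every Λ = 0 MGHD 𝒟 of D (VacuumCauchyDevelopment, IsMaximal): complete
𝓘⁺ (sojourn form) and ∃ O, d : FinalStateDecomposition 𝒟 O 2 with sub-extremal holes, O = exteriorOf
𝒟 d.charted, RaysStayInClosure 𝒟 O, HasExhaustiveCharts d (honest radii) and IsFutureOriented d —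
the re-typed Statement's ∀-MGHD clause verbatim. Mechanism: Cauchy stability in H on the anchored
slabs (age ≤ A), uniform C³ control and diagonal extraction of charts, limits of causal curves in
compact regions; the global clauses (complete 𝓘⁺, complete rays in closure O) are the delicate part. -/
@[route_item "route-FinalStateConjecture-LambdaRegulator", crux]
def LimitTransport : Prop :=
  open Literature.Geometry.Lorentzian Summit.FinalStateConjecture in ∀ (X : Type) [TopologicalSpace X] [ChartedSpace E3 X] [IsManifold (𝓡 3) ∞ X] [T2Space X] [SecondCountableTopology X] [ConnectedSpace X], ∀ D ∈ admissibleVacuumData X, (∃ (F : EuclideanSpace ℝ (Fin 1) → InitialDataSet (𝓡 3) X) (H₀ : ℝ), InitialDataSet.IsSmoothDataFamily 1 F ∧ F 0 = D ∧ 0 < H₀ ∧ (∀ H : ℝ, 0 < H → H ≤ H₀ → let D' := F (EuclideanSpace.single 0 H); ∀ [D'.metric.HasLeviCivita], (∀ x, D'.hamiltonianConstraintFn x = 6 * H ^ 2 ∧ D'.momentumConstraintFn x = 0) ∧ D'.IsComplete) ∧ ∃ (N : ℕ) (mass spin : Fin N → ℝ) (motion : Fin N → lorentzGroup × E4) (τ₀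 : ℝ) (ρ : Fin N → ℝ → ℝ) (U₀ : TopologicalSpace.Opens E4) (μ : ℝ → ℝ → ENNReal) (μ₀ : ℝ → ENNReal) (σ : ℝ → ℝ → ℝ → ENNReal) (σ₀ : ℝ → ℝ → ENNReal) (A : ℝ → ℝ → ENNReal) (A₀ : ℝ → ENNReal) (τsep : ℝ → ℝ) (Rg : Fin N → ℝ → ℝ), let B : Fin N → ModelBackground := fun i ↦ boostedKerrBackground (motion i).1 (motion i).2 (mass i) (spin i); let B₀ : ModelBackground := Minkowski.backgroundOn U₀; (∀ i, Kerr.IsSubextremal (mass i) (spin i)) ∧ (∀ i, IsOrthochronous (motion i).1) ∧ (∀ R, Filter.Tendsto (μ R) Filter.atTop (𝓝 0)) ∧ Filter.Tendsto μ₀ Filter.atTop (𝓝 0) ∧ (∀ R T, Filter.Tendsto (fun H ↦ ⨆ τ ∈ Set.Icc (τ₀ + T⁻¹) T, σ H R τ) (𝓝[>] 0) (𝓝 0)) ∧ (∀ T, Filter.Tendsto (fun H ↦ ⨆ τ ∈ Set.Icc (τ₀ + T⁻¹) T, σ₀ H τ) (𝓝[>] 0) (𝓝 0)) ∧ (∀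 R τ, A R τ < ⊤) ∧ (∀ τ, A₀ τ < ⊤) ∧ (∀ i, Filter.Tendsto (fun τ ↦ μ (Rg i τ) τ) Filter.atTop (𝓝 0)) ∧ (∀ i, Filter.Tendsto (Rg i) Filter.atTop Filter.atTop ∧ ∀ τ, max (Kerr.rPlus (mass i) (spin i)) 0 + 1 ≤ Rg i τ) ∧ (∀ i, Filter.Tendsto (fun t ↦ ρ i t / t) Filter.atTop (𝓝 0)) ∧ {x : E4 | τ₀ < x 0 ∧ ∀ i, ρ i (x 0) < (B i).radius x} ⊆ (U₀ : Set E4) ∧ ∀ H : ℝ, 0 < H → H ≤ H₀ → let IsΛMGHD : CauchyDevelopment (F (EuclideanSpace.single 0 H)) → Prop := fun 𝒟 ↦ 𝒟.IsMaximalAmong (fun 𝒟' ↦ ∀ [𝒟'.metric.toPseudoRiemannianMetric.HasLeviCivita], 𝒟'.metric.toPseudoRiemannianMetric.IsEinsteinVacuum (3 * H ^ 2)); (∃ 𝒟, IsΛMGHD 𝒟) ∧ ∀ 𝒟, IsΛMGHD 𝒟 → HasCompleteNullInfinity 𝒟 ∧ ∃ (Ψ : ∀ i, (B i).domain → 𝒟.carrier)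 (Ψ₀ : B₀.domain → 𝒟.carrier), let O : Set 𝒟.carrier := exteriorOf 𝒟 ((⋃ i, Ψ i '' (B i).lateRegion τ₀) ∪ Ψ₀ '' B₀.lateRegion τ₀); (∀ i, 𝒟.toSpacetime.IsLateChart (B i) O τ₀ (Ψ i)) ∧ 𝒟.toSpacetime.IsLateChart B₀ O τ₀ Ψ₀ ∧ (∀ i R τ, τ₀ < τ → 𝒟.toSpacetime.truncDeviationCk (B i) (Ψ i) 2 R τ ≤ μ R τ + σ H R τ) ∧ (∀ τ, τ₀ < τ → 𝒟.toSpacetime.deviationCk B₀ Ψ₀ 2 τ ≤ μ₀ τ + σ₀ H τ) ∧ (∀ i R τ, τ₀ < τ → ∀ x ∈ (B i).truncTimeSlab R τ, ∀ y : X, 𝒟.toSpacetime.lorentzDist (𝒟.embed y) (Ψ i x) ≤ A R τ) ∧ (∀ τ, τ₀ < τ → ∀ x ∈ B₀.timeSlab τ, ∀ y : X, 𝒟.toSpacetime.lorentzDist (𝒟.embed y) (Ψ₀ x) ≤ A₀ τ) ∧ (∀ R τ₁, τsep R ≤ τ₁ → Pairwise (Function.onFun Disjoint fun i ↦ Ψ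 i '' (B i).truncLateRegion τ₁ R)) ∧ RaysStayInClosure 𝒟 O ∧ (∀ i (R : ℝ), ∀ᶠ τ in Filter.atTop, ∀ x ∈ (B i).truncTimeSlab R τ, 𝒟.timeOrientation.IsFutureDirected (mfderiv 𝓘(ℝ, E4) (𝓡 4) (Ψ i) x (((motion i).1 : E4 ≃L[ℝ] E4) (Kerr.timeVector (mass i) (spin i) (poincareInv (motion i).1 (motion i).2 (x : E4)))))) ∧ (∀ᶠ τ in Filter.atTop, ∀ x ∈ B₀.timeSlab τ, 𝒟.timeOrientation.IsFutureDirected (mfderiv 𝓘(ℝ, E4) (𝓡 4) Ψ₀ x (E4.basisVector 0))) ∧ (∀ τ₁, τ₀ < τ₁ → O \ (Ψ₀ '' B₀.lateRegion τ₁ ∪ ⋃ i, Ψ i '' {x | τ₁ < (B i).time x.1 ∧ (B i).radius x.1 ≤ Rg i ((B i).time x.1)}) ⊆ 𝒟.metric.causalPast 𝒟.timeOrientation (Ψ₀ '' B₀.timeSlab τ₁ ∪ ⋃ i, Ψ i '' (B i).truncTimeSlab (Rg i τ₁) τ₁))) → ∀ 𝒟 : VacuumCauchyDevelopment D, 𝒟.IsMaximal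 → HasCompleteNullInfinity 𝒟.toCauchyDevelopment ∧ ∃ (O : Set 𝒟.carrier) (d : FinalStateDecomposition 𝒟.toSpacetime O 2), (∀ i, Kerr.IsSubextremal (d.mass i) (d.spin i)) ∧ O = exteriorOf 𝒟.toCauchyDevelopment d.charted ∧ RaysStayInClosure 𝒟.toCauchyDevelopment O ∧ HasExhaustiveCharts d ∧ IsFutureOriented d

-- item stmt-FinalStateConjecture-10110 · crux · rank 4 · open · by planner — informal only, no Lean statement yet:
--   [crux] (card K1 — the load-bearing uniformity bet, perturbative form; untyped until the definition
--   request KerrDeSitter.background / KerrDeSitter.data lands) Λ-UNIFORM KERR–DE SITTER CAPTURE: for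
--   every compact set of sub-extremal parameters (M, a), |a| < M, there are ε₀, C, H₀ > 0 and a
--   rate-free modulus μ(R, τ) → 0 (τ → ∞), all INDEPENDENT of H ∈ (0, H₀] (Λ = 3H², so ΛM² ≤ 3H₀²M² ≪ 1,
--   sub-Nariai), such that: if Λ-vacuum Cauchy data on a horizon-crossing slice {t* = 0, r > r₀} of the
--   Kerr–de Sitter chart KdS(M, a, Λ) (regular across the event AND the cosmological horizon) are ε ≤ ε₀
--   close to t

-- earlier PunctureTheorem (stmt-FinalStateConjecture-10111, replaced 2026-08-15T22:02:19Z -> stmt-FinalStateConjecture-13855): retired by None — [crux] (card K2+K3+K4 at FIXED Λ — the Λ > 0 rung FSC_Λ, the engine by which UniformLambdaSettling is to be proved; untyped until KerrDeSitter.background lands) PUNCTURE THEOREM ON SPACELIKE SCRI: fix H ∈ (0, H₀] and the regularised datum D_H = F(H) of a Ch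
-- earlier PunctureTheorem (stmt-FinalStateConjecture-13855, replaced 2026-08-16T23:19:21Z -> stmt-FinalStateConjecture-17443): retired by None — ∀ (X : Type) [TopologicalSpace X] [ChartedSpace Literature.Geometry.Lorentzian.E3 X] [IsManifold (𝓡 3) ∞ X] [T2Space X] [SecondCountableTopology X] [ConnectedSpace X], Literature.Geometry.Lorentzian.InitialDataSet.IsChristodoulouGeneric (Literature.Geometry
/-- item stmt-FinalStateConjecture-17443 · crux · rank 5 · open · by planner
why it might fail: Open at every leg (large-data FSC_Λ, tame-generic); a dynamically STABLE spinning dS binary (arXiv:2406.10333 p.5, open) refutes it on an open set; KdS uniqueness unproved (1711.07024); Zeno cascades = Λ=0 finiteness sub-crux; H-uniform census, unique planar C² conformal boundary are extra bets.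
sources: arXiv:2001.10401, arXiv:1606.04014, arXiv:2112.07183, arXiv:2303.07361, arXiv:2406.10333, arXiv:1711.07024
[crux] (repaired + TYPED 2026-08-15 after crux attacks g0/g2, verdict refuted-misstated; card
K2+K3+K4 at FIXED Λ — the Λ > 0 rung FSC_Λ with an H-uniform census, the engine by which
UniformLambdaSettling is to be proved) PUNCTURE THEOREM ON SPACELIKE SCRI: for
TAME-Christodoulou-generic (rev 6: the re-typed Statement's genericity, p126844) admissible Λ = 0
data D there are a jointly smooth regularising family F (F(0) = D; F(H), 0 < H ≤ H₀, a complete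
solution of the Λ = 3H² vacuum constraints — the clause of UniformLambdaSettling), a bound N₀ and a
compact set K of sub-extremal Kerr parameters (|a| < M, so masses ≥ m₀(D) > 0), all INDEPENDENT of
H, such that for every 0 < H ≤ H₀ a Λ-MGHD of F(H) exists and EVERY Λ-MGHD 𝒟 (CauchyDevelopment
maximal among Ric = 3H²g developments) admits: N ≤ N₀ holes with (Mᵢ, aᵢ) ∈ K, Kerr–de
Sitter-subextremal at Λ = 3H²; a C² conformal completion C of 𝒟 (ConformalInfinity.lean: g̃ = Ω²g, Ω
= 0 ≠ dΩ on the boundary) whose future boundary 𝓘⁺ is the WHOLE PLANAR-END COMPONENT — (Ends)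
outside a compact subset of X the future unit-normal geodesics of the data are future complete and
converge in M̃ to points of 𝓘⁺, and the black-hole region B = M ∖ J⁻ -/
@[route_item "route-FinalStateConjecture-LambdaRegulator"]
def PunctureTheorem : Prop :=
  ∀ (X : Type) [TopologicalSpace X] [ChartedSpace Literature.Geometry.Lorentzian.E3 X] [IsManifold (𝓡 3) ∞ X] [T2Space X] [SecondCountableTopology X] [ConnectedSpace X], Literature.Geometry.Lorentzian.InitialDataSet.IsTameChristodoulouGeneric (Literature.Geometry.Lorentzian.admissibleVacuumData X) (fun D ↦ ∃ (F : EuclideanSpace ℝ (Fin 1) → Literature.Geometry.Lorentzian.InitialDataSet (𝓡 3) X) (H₀ : ℝ), Literature.Geometry.Lorentzian.InitialDataSet.IsSmoothDataFamily 1 F ∧ F 0 = D ∧ 0 < H₀ ∧ (∀ H : ℝ, 0 < H → H ≤ H₀ → let D' := F (EuclideanSpace.single 0 H); ∀ [D'.metric.HasLeviCivita], (∀ x, D'.hamiltonianConstraintFn x = 6 * H ^ 2 ∧ D'.momentumConstraintFn x = 0) ∧ D'.IsComplete) ∧ ∃ (N₀ : ℕ) (K : Set (ℝ × ℝ)), IsCompact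 K ∧ K ⊆ {p | Literature.Geometry.Lorentzian.Kerr.IsSubextremal p.1 p.2} ∧ ∀ H : ℝ, 0 < H → H ≤ H₀ → let IsΛMGHD : Literature.Geometry.Lorentzian.CauchyDevelopment (F (EuclideanSpace.single 0 H)) → Prop := fun 𝒟 ↦ 𝒟.IsMaximalAmong (fun 𝒟' ↦ ∀ [𝒟'.metric.toPseudoRiemannianMetric.HasLeviCivita], 𝒟'.metric.toPseudoRiemannianMetric.IsEinsteinVacuum (3 * H ^ 2)); (∃ 𝒟, IsΛMGHD 𝒟) ∧ ∀ 𝒟, IsΛMGHD 𝒟 → ∀ [𝒟.metric.HasLeviCivita], ∃ (N : ℕ) (mass spin : Fin N → ℝ) (C : Literature.Geometry.Lorentzian.ConformalCompletion 𝒟.toSpacetime) (τ₀ : ℝ), N ≤ N₀ ∧ (∀ i, (mass i, spin i) ∈ K ∧ Literature.Geometry.Lorentzian.KerrDeSitter.IsSubextremal (mass i) (spin i) (3 * H ^ 2)) ∧ let B : Fin N → Literature.Geometry.Lorentzian.ModelBackground := fun i ↦ Literature.Geometry.Lorentzian.KerrDeSitter.background (mass i) (spin i) (3 * H ^ 2)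 (Literature.Geometry.Lorentzian.KerrDeSitter.rPlus (mass i) (spin i) (3 * H ^ 2)); let Ends : Literature.Geometry.Lorentzian.ConformalCompletion 𝒟.toSpacetime → Prop := fun C' ↦ ∃ 𝒦 : Set X, IsCompact 𝒦 ∧ ∀ x ∉ 𝒦, ∀ (γ : ℝ → 𝒟.carrier) (s : Set ℝ), Literature.Geometry.Lorentzian.IsMaximalGeodesicOn 𝒟.metric.leviCivita γ s → 0 ∈ s → γ 0 = 𝒟.embed x → Literature.Geometry.Lorentzian.velocity (𝓡 4) γ 0 = 𝒟.normal x → ¬ BddAbove s ∧ ∃ q ∈ C'.futureNullInfinity, Filter.Tendsto (C'.φ ∘ γ) Filter.atTop (𝓝 q); ∃ (Ψ : ∀ i, (B i).domain → 𝒟.carrier), let O : Set 𝒟.carrier := 𝒟.metric.causalFuture 𝒟.timeOrientation (range 𝒟.embed) ∩ C.φ ⁻¹' (C.gTilde.chronologicalPast C.τTilde C.futureNullInfinity); Ends C ∧ (∀ C' : Literature.Geometry.Lorentzian.ConformalCompletion 𝒟.toSpacetime, IsConnected C'.futureNullInfinity → Ends C' → C.blackHoleRegion ⊆ C'.blackHoleRegion)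 ∧ (∃ P : Fin N → Literature.Geometry.Lorentzian.E3, Function.Injective P ∧ Nonempty (C.futureNullInfinity ≃ₜ ((Set.range P)ᶜ : Set Literature.Geometry.Lorentzian.E3))) ∧ (∀ i, 𝒟.toSpacetime.IsLateChart (B i) O τ₀ (Ψ i)) ∧ (∀ i R, Filter.Tendsto (fun τ ↦ 𝒟.toSpacetime.truncDeviationCk (B i) (Ψ i) 2 R τ) Filter.atTop (𝓝 0)) ∧ (∀ R, ∃ τ₁, Pairwise (Function.onFun Disjoint fun i ↦ Ψ i '' (B i).truncLateRegion τ₁ R)) ∧ ∀ (γ : ℝ → 𝒟.carrier) (s : Set ℝ), Literature.Geometry.Lorentzian.IsMaximalGeodesicOn 𝒟.metric.leviCivita γ s → s.Nonempty → (∀ t ∈ s, 𝒟.timeOrientation.IsFutureDirected (Literature.Geometry.Lorentzian.velocity (𝓡 4) γ t)) → (∀ t ∈ s, γ t ∉ C.blackHoleRegion) → ¬ BddAbove s ∧ ((∀ t ∈ s, 𝒟.metric.IsTimelike (Literature.Geometry.Lorentzian.velocity (𝓡 4) γ t)) → (∃ q ∈ C.futureNullInfinity, Filter.Tendsto (C.φ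 ∘ γ) Filter.atTop (𝓝 q)) ∨ ∃ i R, ∀ᶠ t in Filter.atTop, γ t ∈ Ψ i '' (B i).truncLateRegion τ₀ R)) 1

/-- item stmt-FinalStateConjecture-9990 · crux · rank 9 · open · by planner
why it might fail: Known in print (CBG 1969 Thm 3 + Sbierski 2016 = unproved tree fact choquetBruhat_geroch_exists_mghd_cauchy, XL) but typing-exposed: IsMaximal needs EVERY typed VacuumCauchyDevelopment of D to embed ι-compatibly into one 𝒟; a rogue typed development kills it (g5 VacuumDevelopment was isEmpty).
sources: ChoquetBruhatGeroch1969CMP, Sbierski2016AHP, Ringstrom2009, arXiv:1309.7591, Literature.Geometry.Lorentzian.choquetBruhat_geroch_exists_mghd_cauchy, Literature.Geometry.Lorentzian.choquetBruhat_geroch_exists_mghd_cauchy.forall_mem_admissibleVacuumData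
[support] Choquet-Bruhat–Geroch over the repaired development structure, restricted to the
admissible class: every admissible vacuum datum has a maximal vacuum Cauchy development
(VacuumCauchyDevelopment, IsMaximal). The prelude deliberately does not yet declare this named fact
(CauchyProblemCauchy.lean, D-0026); it is the anti-vacuity conjunct of the Statement and is consumed
by `closes`. [difficulty: XL] -/
@[route_item "route-FinalStateConjecture-LambdaRegulator", crux]
def MGHDExistence : Prop :=
  ∀ (X : Type) [TopologicalSpace X] [ChartedSpace Literature.Geometry.Lorentzian.E3 X] [IsManifold (𝓡 3) ∞ X] [T2Space X] [SecondCountableTopology X] [ConnectedSpace X], ∀ D ∈ Literature.Geometry.Lorentzian.admissibleVacuumData X, ∃ 𝒟 : Literature.Geometry.Lorentzian.VacuumCauchyDevelopment D, 𝒟.IsMaximal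

/-- item stmt-FinalStateConjecture-10061 · support · rank 9 · open · by planner
sources: arXiv:gr-qc/0301073, arXiv:gr-qc/0301071, BartnikIsenberg2004
[support] the cheap half of UniformLambdaSettling, for EVERY admissible datum: D = (h, k) lies on a
jointly smooth one-parameter family F with F(0) = D and F(H), 0 < H ≤ H₀, a complete solution of the
Λ = 3H² vacuum constraints. Intended proof: implicit function theorem for Θ(H, γ, π) := C₀(h + γ, k
+ π) + 4H (tr(k + π), 0) — the Λ-constraint map of the umbilically shifted datum (h + γ, k + π + H(h
+ γ)) — around (0, 0, 0), in weighted spaces on the AF end where the linearised vacuum constraint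
map is a submersion modulo the finite-dimensional KID cokernel (Lyapunov–Schmidt step at symmetric
data); the shift absorbs the non-decaying 6H² exactly, the residual 4H tr k = H·o(r⁻²) decays;
completeness survives the decaying correction. [difficulty: M] -/
@[route_item "route-FinalStateConjecture-LambdaRegulator"]
def RegularisationExists : Prop :=
  ∀ (X : Type) [TopologicalSpace X] [ChartedSpace Literature.Geometry.Lorentzian.E3 X] [IsManifold (𝓡 3) ∞ X] [T2Space X] [SecondCountableTopology X] [ConnectedSpace X], ∀ D ∈ Literature.Geometry.Lorentzian.admissibleVacuumData X, ∃ (F : EuclideanSpace ℝ (Fin 1) → Literature.Geometry.Lorentzian.InitialDataSet (𝓡 3) X) (H₀ : ℝ), Literature.Geometry.Lorentzian.InitialDataSet.IsSmoothDataFamily 1 F ∧ F 0 = D ∧ 0 < H₀ ∧ ∀ H : ℝ, 0 < H → H ≤ H₀ → let D' := F (EuclideanSpace.single 0 H); ∀ [D'.metric.HasLeviCivita], (∀ x, D'.hamiltonianConstraintFn x = 6 * H ^ 2 ∧ D'.momentumConstraintFn x = 0) ∧ D'.IsComplete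

-- earlier UniformDispersal (stmt-FinalStateConjecture-11113, replaced 2026-08-16T23:19:21Z -> stmt-FinalStateConjecture-17442): retired by None — ∃ (s : ℕ), ∃ δ ∈ Set.Ioo (-3 / 2 : ℝ) (-1 / 2), ∃ ε > (0 : ℝ), ∀ D ∈ Literature.Geometry.Lorentzian.admissibleVacuumData Literature.Geometry.Lorentzian.Minkowski.slice, Literature.Geometry.Lorentzian.InitialDataSet.dataWeightedSobolevEDist s δ D Literature
-- earlier UniformDispersal (stmt-FinalStateConjecture-17442, replaced 2026-08-16T23:48:33Z -> stmt-FinalStateConjecture-18032): retired by None — open Literature.Geometry.Lorentzian Summit.FinalStateConjecture in ∃ (s : ℕ), ∃ δ ∈ Set.Ioo (-3 / 2 : ℝ) (-1 / 2), ∃ ε > (0 : ℝ), ∀ D ∈ admissibleVacuumData Minkowski.slice, InitialDataSet.dataWeightedSobolevEDist s δ D trivialData < ENNReal.ofReal ε → ∃ (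
-- earlier UniformDispersal (stmt-FinalStateConjecture-18032, replaced 2026-08-16T23:50:36Z -> stmt-FinalStateConjecture-18038): retired by None — open Literature.Geometry.Lorentzian Summit.FinalStateConjecture in ∃ (s : ℕ), ∃ δ ∈ Set.Ioo (-3 / 2 : ℝ) (-1 / 2), ∃ ε > (0 : ℝ), ∀ [ConnectedSpace (⊤ : TopologicalSpace.Opens E3)], ∀ D ∈ admissibleVacuumData (⊤ : TopologicalSpace.Opens E3), weightedSobole
/-- item stmt-FinalStateConjecture-18038 · support · rank 9 · open · by planner
why it might fail: Fixed-Λ de Sitter stability (Friedrich/Ringström) has constants degenerating as Λ→0; the H-uniform limit must contain rate-free Minkowski stability with complete scri on whole slabs in the DR class (known only in Bieri's class), via a scheme interpolating conformal and vector-field methods.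
sources: doi:10.1016/0393-0440(86)90004-5, doi:10.1007/s00222-008-0117-y, LindbladRodnianski2010, ChristodoulouKlainerman1993PMS41, Bieri2010JDG, arXiv:gr-qc/0301071
[support] (N = 0 rung of UniformLambdaSettling; rev 12: ModelData-free RE-SPELLING of rev 6
stmt-FinalStateConjecture-17442 (via rev 11 stmt-18032, whose inherited item-level import of
ModelData this revision removes; smallness domains spelled `Set.univ`), proved equivalent —
`uniformDispersal_new_iff_old` in the repair planner's Equiv2.lean, axioms standard:
`Minkowski.slice` is `⊤ : Opens E3` by definition, `dataWeightedSobolevEDist s δ D trivialData`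
unfolds to ‖h − δ‖_{H^s_δ(ℝ³)} + ‖k‖_{H^{s−1}_{δ+1}(ℝ³)} since `trivialData.hFun = innerSL ℝ` and
`trivialData.kFun = 0`, and the bound instance `[ConnectedSpace ↥⊤]` is ModelData's by proof
irrelevance; the import Literature.Geometry.Lorentzian.ModelData, which carried the
refuted-as-stated vocabulary fact Minkowski.isCauchySurface_range_sliceEmbed into the route's import
cone, is dropped) Λ → 0⁺-UNIFORM SMALL-DATA DISPERSAL: there are s, δ ∈ (−3/2, −1/2), ε > 0 (the
gr.S04 smallness class: weighted Sobolev distance of (h, k) to the trivial datum (δ, 0) on ℝ³ = ⊤ ⊆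
E3) such that every ε-small admissible Λ = 0 datum D on ℝ³ has the N = 0 instance of Φ: a
regularising family F (F(0) = D; F(H), 0 < H ≤ H₀, complete Λ = 3H² constraint -/
@[route_item "route-FinalStateConjecture-LambdaRegulator"]
def UniformDispersal : Prop :=
  open Literature.Geometry.Lorentzian Summit.FinalStateConjecture in ∃ (s : ℕ), ∃ δ ∈ Set.Ioo (-3 / 2 : ℝ) (-1 / 2), ∃ ε > (0 : ℝ), ∀ [ConnectedSpace (⊤ : TopologicalSpace.Opens E3)], ∀ D ∈ admissibleVacuumData (⊤ : TopologicalSpace.Opens E3), weightedSobolevSeminorm (Set.univ : Set E3) s δ (D.hFun - fun _ ↦ (innerSL ℝ : E3 →L[ℝ] E3 →L[ℝ] ℝ)) + weightedSobolevSeminorm (Set.univ : Set E3) (s - 1) (δ + 1) D.kFun < ENNReal.ofReal ε → ∃ (F : EuclideanSpace ℝ (Fin 1) → InitialDataSet (𝓡 3) (⊤ : TopologicalSpace.Opens E3)) (H₀ : ℝ), InitialDataSet.IsSmoothDataFamily 1 F ∧ F 0 = D ∧ 0 < H₀ ∧ (∀ H : ℝ, 0 < H → H ≤ H₀ → let D'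 := F (EuclideanSpace.single 0 H); ∀ [D'.metric.HasLeviCivita], (∀ x, D'.hamiltonianConstraintFn x = 6 * H ^ 2 ∧ D'.momentumConstraintFn x = 0) ∧ D'.IsComplete) ∧ ∃ (τ₀ : ℝ) (U₀ : TopologicalSpace.Opens E4) (μ₀ : ℝ → ENNReal) (σ₀ : ℝ → ℝ → ENNReal) (A₀ : ℝ → ENNReal), let B₀ : ModelBackground := Minkowski.backgroundOn U₀; Filter.Tendsto μ₀ Filter.atTop (𝓝 0) ∧ (∀ T, Filter.Tendsto (fun H ↦ ⨆ τ ∈ Set.Icc (τ₀ + T⁻¹) T, σ₀ H τ) (𝓝[>] 0) (𝓝 0)) ∧ (∀ τ, A₀ τ < ⊤) ∧ {x : E4 | τ₀ < x 0} ⊆ (U₀ : Set E4) ∧ ∀ H : ℝ, 0 < H → H ≤ H₀ → let IsΛMGHD : CauchyDevelopment (F (EuclideanSpace.single 0 H)) → Prop := fun 𝒟 ↦ 𝒟.IsMaximalAmong (fun 𝒟' ↦ ∀ [𝒟'.metric.toPseudoRiemannianMetric.HasLeviCivita], 𝒟'.metric.toPseudoRiemannianMetric.IsEinsteinVacuum (3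 * H ^ 2)); (∃ 𝒟, IsΛMGHD 𝒟) ∧ ∀ 𝒟, IsΛMGHD 𝒟 → HasCompleteNullInfinity 𝒟 ∧ ∃ (Ψ₀ : B₀.domain → 𝒟.carrier), let O : Set 𝒟.carrier := exteriorOf 𝒟 (Ψ₀ '' B₀.lateRegion τ₀); 𝒟.toSpacetime.IsLateChart B₀ O τ₀ Ψ₀ ∧ (∀ τ, τ₀ < τ → 𝒟.toSpacetime.deviationCk B₀ Ψ₀ 2 τ ≤ μ₀ τ + σ₀ H τ) ∧ (∀ τ, τ₀ < τ → ∀ x ∈ B₀.timeSlab τ, ∀ y : (⊤ : TopologicalSpace.Opens E3), 𝒟.toSpacetime.lorentzDist (𝒟.embed y) (Ψ₀ x) ≤ A₀ τ) ∧ RaysStayInClosure 𝒟 O ∧ (∀ᶠ τ in Filter.atTop, ∀ x ∈ B₀.timeSlab τ, 𝒟.timeOrientation.IsFutureDirected (mfderiv 𝓘(ℝ, E4) (𝓡 4) Ψ₀ x (E4.basisVector 0))) ∧ (∀ τ₁, τ₀ < τ₁ → O \ Ψ₀ '' B₀.lateRegion τ₁ ⊆ 𝒟.metric.causalPast 𝒟.timeOrientation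 (Ψ₀ '' B₀.timeSlab τ₁))

/-- item stmt-FinalStateConjecture-10062 · assembly · rank 1 · open · by planner
sources: Christodoulou1999, DafermosLuk2017
[assembly] UniformLambdaSettling → LimitTransport → MGHDExistence → FinalStateConjecture (genericity
monotonicity). -/
@[route_item "route-FinalStateConjecture-LambdaRegulator"]
def Assembly : Prop :=
  UniformLambdaSettling → LimitTransport → MGHDExistence → FinalStateConjecture

/-! D-0027 §2.1 — DECIDING THEOREM (planner-authored via `route open/edit --closes-file`; by planner-rbadge-FinalStateConjecture-LambdaRegu-9250c668-0 2026-08-16T23:48:33Z):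
its hypotheses are this route's items and its conclusion the sub-problem Statement (glue_lint), and it elaborates with this file. -/

/- glue.lean — the deciding theorem of route LambdaRegulator (D-0027 §2.1); route-repair rbadge-9250c668,
   2026-08-16 (rev 11: import cone trimmed — `Literature.Geometry.Lorentzian.ModelData` dropped, the N = 0 rung
   UniformDispersal re-spelled ModelData-free; `closes` unchanged in content, re-certified natively).
   Tame Christodoulou genericity is monotone under implication inside the admissible class: LimitTransport +
   MGHDExistence turn the anchored uniform Λ-settling property Φ of an admissible datum into the Statement's
   property P, so the P-exceptional set lies inside the Φ-exceptional set and the tame immersed injective witness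
   family that UniformLambdaSettling supplies through a P-exceptional datum (one fixed end e) leaves the
   P-exceptional set as well. Crux-only: h₁ h₂ h₃ are crux items of this route (MGHDExistence, rank 9, supplies the
   Statement's anti-vacuity conjunct ∃ MGHD). Axioms: propext, Classical.choice, Quot.sound. -/
@[closes "route-FinalStateConjecture-LambdaRegulator"] theorem closes (h₁ : UniformLambdaSettling) (h₂ : LimitTransport) (h₃ : MGHDExistence) :
    _root_.FinalStateConjecture := by
  intro X _ _ _ _ _ _ d hd
  -- P(D): the Statement's property of an admissible datum D (∃ MGHD, and every MGHD settles down)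
  -- Φ(D) → P(D) on the admissible class: LimitTransport gives the ∀-MGHD clause, MGHDExistence the ∃-MGHD clause
  have hΦP : ∀ D ∈ Literature.Geometry.Lorentzian.admissibleVacuumData X, _ →
      ((∃ 𝒟 : Literature.Geometry.Lorentzian.VacuumCauchyDevelopment D, 𝒟.IsMaximal) ∧
        ∀ 𝒟 : Literature.Geometry.Lorentzian.VacuumCauchyDevelopment D, 𝒟.IsMaximal →
          Summit.FinalStateConjecture.HasCompleteNullInfinity 𝒟.toCauchyDevelopment ∧
            ∃ (O : Set 𝒟.carrier) (d : Literature.Geometry.Lorentzian.FinalStateDecomposition 𝒟.toSpacetime O 2),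
              (∀ i, Literature.Geometry.Lorentzian.Kerr.IsSubextremal (d.mass i) (d.spin i)) ∧
                O = Summit.FinalStateConjecture.exteriorOf 𝒟.toCauchyDevelopment d.charted ∧
                  Summit.FinalStateConjecture.RaysStayInClosure 𝒟.toCauchyDevelopment O ∧
                    Summit.FinalStateConjecture.HasExhaustiveCharts d ∧
                      Summit.FinalStateConjecture.IsFutureOriented d) :=
    fun D hD hΦ ↦ ⟨h₃ X D hD, h₂ X D hD hΦ⟩
  -- the given P-exceptional admissible datum d is Φ-exceptional, so UniformLambdaSettling supplies a witness
  obtain ⟨e, F, hF, hImm, h0, hinj, hadm, hexc⟩ := h₁ X d ⟨hd.1, fun hΦ ↦ hd.2 (hΦP d hd.1 hΦ)⟩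
  -- every other member of the family satisfies Φ, hence P
  exact ⟨e, F, hF, hImm, h0, hinj, hadm, fun c hc hmem ↦ hexc c hc ⟨hmem.1, fun hΦ ↦ hmem.2 (hΦP (F c) hmem.1 hΦ)⟩⟩

end Summit.FinalStateConjecture.FinalStateConjecture.Theses.LambdaRegulator
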